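import Literature.MathematicalPhysics.QuantumFieldTheory.Balaban1983to89.B9Eq3126H1BlockDecayTower
import Literature.MathematicalPhysics.QuantumFieldTheory.Balaban1983to89.B9Eq3126ClosingRadiusWindow

/-!
# `Balaban1983to89.B9Eq3126H1BlockDecayUniformRadiusTower` — T. Bałaban, *Propagators for lattice gauge theories in a background field*, Commun. Math. Phys. **99**
# (1985) 389–434 [Balaban1985BackgroundPropagators] (3.15)∕(3.16) p. 393, (3.26) p. 395, (3.49) p. 399 («the constants … are independent of the field configuration
# and of `k`»), (3.126) p. 420, Thm 3.11 p. 416 with [Balaban1985Variational] (45) p. 285: **THE TOWER `H₁` ROW IN `∃`-FIRST FORM — ONE RATE `r₀ > 0`, A FUNCTION OF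
# THE HEIGHT-FREE, U-INDEPENDENT LETTERS ONLY, BEFORE THE HEIGHT `n` AND BEFORE THE BACKGROUND** — the tower twin of `B9Eq3126H1BlockDecayUniformRadius`: given
# `γ, μ₁, p_K < γ∕2, a, C_Q, κ₁, s_A`, the slopes `N_β, N_K`, `ℓ, ℓ′`, the fibre readings, and a consumer's cap `R` with `R·ℓ ≤ L` (so that the radius window
# `rℓη ≤ 1` holds at EVERY height, `η = L^{−(n+1)}`): `∃ r₀`, `0 < r₀ ≤ R`, `N_βr₀ ≤ 1`, and THEN `∀ n`, `∀ η` with `ηL^{n+1} = 1`, `∀ U` on `towerP L m (n+1)` with the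
# displayed letters (the conjugated `Q_k` ∕ `Δ′` ∕ `R_k(U)` letters LINEAR in the radius on `[0, r₀]`, the `Q_k†` block-to-point letter `C_Q†` at rate `r₀`):
# `‖P_{y₁} ∘ H₁,k(U) ∘ r_{y₀}‖ ≤ (4∕γ)e^{r₀}·C_Q†·(2∕μ₁)e^{r₀}·K_d(r₀∕2)²·e^{−(r₀∕2)·d_m(y₀,y₁)}` — `B9Eq3126H1BlockDecayTower.norm_block_H1k_le` at the radius of
# `B9Eq3126ClosingRadiusWindow.exists_radius_closing` capped by `R`

statement-level skeleton of published theorems with citation tags; proofs where landed; nothing here is a claim about the Yang–Mills mass gap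

CITATION HEADER (lean-in-tree rule).  Audit cell `pub-balaban`, sub-cell `t4`, BINDER row NE9 (road ΔA-CT of the NE9 formalisation swarm, leaf prover 03
`b2b-balaban-t4-ne9-formalise-leaf-03` gen 76).  Imports this lineage's (H1DT) `B9Eq3126H1BlockDecayTower` and (CRW) `B9Eq3126ClosingRadiusWindow`.  Sources READ
first-hand: [Balaban1985BackgroundPropagators] p. 399 (3.49) (print's `δ₀`, `O(1)` NOT asserted), p. 393 (3.15)∕(3.16), p. 395 (3.26), p. 416 Thm 3.11, p. 420 (3.126);
[Balaban1985Variational] p. 285 (45).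

WHAT IS PROVED (sorry-free; proof lane — no `def`; [folklore] composition BY NAME + the quantifier order).
* **`exists_rate_block_decay_H1k`** — `∃ r₀`, `r₀ = min r₀^{CRW} R` EXPOSED (closed form of `B9Eq3126ClosingRadiusWindow.radius0_pos`; t4-ne9-idea-1 g149 L-g149-1), `0 < r₀ ≤ R`,
  `N_βr₀ ≤ 1`; then `∀ n η U …`: the tower END at rate `r₀∕2`, the same `r₀` at every height.
HONEST SCOPE.  `r₀` depends on `γ, μ₁, p_K, a, C_Q, κ₁, s_A, N_β, N_K, R` ONLY — it is height-free exactly to the extent those letters are supplied height-free (KD ∕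
KSD for `γ`, (HQA) `norm_block_adjoint_QkW_le_heightFree` for `C_Q†`, (TLW) for the tower `β`-slope, (MU1) §3 for `μ₁` given a height-free `M`); every analytic letter
DISPLAYED inside the `∀`; no number; NOT NE9 (cell pub-balaban: NE9 NOT PRINTED ∕ NOT PROVED; «NE9 ⇐ the named binders»; row WALLED ON A MODEL (O-NE9-1; #5 UNRULED);
spine PROVED 0∕9; rung (B)+1 on a finite T⁴ — NOT infinite volume, NOT mass gap, NOT BetaPertH, NOT Clay; HONEST DEPENDENCY: continuum YM on T⁴ ⇐ BetaPertH ∧ nine spine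
estimates (0/9 proved); BetaPertH ⇐ (D1) ∧ (D4) ∧ CAP+tail).  NEW file; nothing modified.  Net new unproved facts: 0.
-/

noncomputable section

open scoped InnerProductSpace ComplexConjugate
open NormedSpace

namespace Literature.MathematicalPhysics.QuantumFieldTheory.Balaban1983to89.B9Eq3126H1BlockDecayUniformRadiusTower

open B4Sect5Torus (TSite tdist)
open B4Sect5Proof (latticeConst)
open B9SectCLatticeCarrier (Bond bpos btgt)
open B9Eq311L2Pairing (WL2)
open B9Eq319QprimeTorus (fineP blockCoord)
open B9Eq315QTower (towerP)
open B9Eq315QTorus (perCfg cornerSite)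
open B7Prop1Explicit (Wcx boxVec U1)
open B9Eq316TowerFlatIsOneStep (siteCast towerP_eq_fineP_pow)
open B11Eq103H1Complex (SiteL2K BondL2K covDivL2K KinvLatticeK)
open B9Eq310HessianOperator (adTransportW PlaqL2K curvOp)
open B9Eq326OperatorTower (laplaceAk RofUk G1k H1k QkW)
open B9Eq3126H1BlockDecayTower (norm_block_H1k_le)
open B9Eq3126ClosingRadiusWindow (radius0_pos closing_of_r_le_radius0)

variable {d : ℕ} (L : ℕ) [NeZero L] (m : Fin d → ℕ) [∀ i, NeZero (m i)]
  {𝔸 : Type*} [NormedRing 𝔸] [StarRing 𝔸] [NormedAlgebra ℂ 𝔸] [StarModule ℂ 𝔸] [CompleteSpace 𝔸] [NormOneClass 𝔸]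
  {W : Type*} [NormedAddCommGroup W] [InnerProductSpace ℂ W] [FiniteDimensional ℂ W] (φ : W ≃ₗ[ℂ] 𝔸) {Mφ Mφ' : ℝ}
  (hφ : ∀ w, ‖φ w‖ ≤ Mφ * ‖w‖) (hφ' : ∀ X, ‖φ.symm X‖ ≤ Mφ' * ‖X‖) (hMφ : 0 ≤ Mφ) (hMφ' : 0 ≤ Mφ')
  {c₀ : ℝ} [Fact (0 < c₀)] {c₁ : ℝ} [Fact (0 < c₁)]
  (τ : 𝔸 →ₗ[ℂ] ℂ) (hL : 1 ≤ L) (α : ℕ → ℝ) (hα1 : ∀ j, α j ≤ 1 / 64) (hαL : ∀ j, 50 * (d + 1) * α j * (L : ℝ) ^ d ≤ 1 / 2) (a : ℝ)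

include hφ hφ' hMφ hMφ' in
/-- **THE TOWER `H₁` ROW, `∃ r₀ > 0` BEFORE THE HEIGHT AND THE BACKGROUND**: see the module header. `r₀ = min r₀^{CRW} R` with the consumer's cap `R`, `R·ℓ ≤ L`
(whence `r₀ℓη ≤ 1` at every height); the `∃` clause exposes `r₀ ≤ R` and `N_βr₀ ≤ 1`. Inside: `∀ n η (ηL^{n+1} = 1) U …` the letters of
`B9Eq3126H1BlockDecayTower.norm_block_H1k_le` with `β := N_βr₀`, `β_K := N_Kr₀`, `ρ := 15(N_βr₀)s_A∕√κ₁`, the conjugation letters asked on `[0, r₀]`.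
[cite: Balaban1985BackgroundPropagators, (3.15) p.393, (3.26) p.395, (3.49) p.399, (3.126) p.420, Thm 3.11 p.416; Balaban1985Variational, (45) p.285] -/
theorem exists_rate_block_decay_H1k (ha : 0 ≤ a) (hm : ∀ i, 1 ≤ m i)
    {γ pK CQ κ₁ sA μ₁ Nβ NK ℓ ℓ' CQa R : ℝ} (hγ : 0 < γ) (hγ1 : γ ≤ 1) (hCQ : 0 ≤ CQ) (hκ₁ : 0 < κ₁) (hsA : 0 < sA) (hμ₁ : 0 < μ₁)
    (hNβ : 0 < Nβ) (hNK : 0 ≤ NK) (hgap : pK < γ / 2) (hℓ : 1 ≤ ℓ) (hℓ' : 1 ≤ ℓ') (hCQa : 0 ≤ CQa)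
    (hNβCC : 4 * ℓ * (Mφ * Mφ') * (d * Real.sqrt d) ≤ Nβ) (hNβC : 4 * ℓ * (Mφ * Mφ') * d ≤ Nβ) (hNβD : 2 * ℓ * (Mφ * Mφ') * Real.sqrt d ≤ Nβ)
    (hR : 0 < R) (hRL : R * ℓ ≤ L) :
    ∃ r₀ : ℝ, r₀ = min (min (1 / Nβ) (min (Real.sqrt κ₁ / (120 * sA * Nβ))
      (min ((γ / 4 - pK / 2) / (Nβ * (4 * Real.sqrt (CQ / Real.sqrt κ₁) + 30 * sA * CQ / κ₁ + (21 + 3 * a)) + NK))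
        ((μ₁ / 2) / (Nβ * (4 / γ * (2 * CQ + 1) + CQ * (CQ + 1) *
          (4 / γ * (2 * (8 / γ) + (8 / γ + 4 / γ) + 2 * ((8 / γ + 4 / γ * Real.sqrt (CQ / Real.sqrt κ₁)) + 4 / γ) + a * CQ * (4 / γ) + a * (CQ + 1) * (4 / γ)) +
            15 * sA * ((8 / γ + 4 / γ * Real.sqrt (CQ / Real.sqrt κ₁)) * ((8 / γ + 4 / γ * Real.sqrt (CQ / Real.sqrt κ₁)) + 4 / γ)) / Real.sqrt κ₁)) +
          NK * (CQ * (CQ + 1) * (4 / γ) ^ 2)))))) R ∧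
      0 < r₀ ∧ r₀ ≤ R ∧ Nβ * r₀ ≤ 1 ∧
      ∀ (n : ℕ) (η : ℝ) (_hη : 0 < η) (_hηL : η * (L : ℝ) ^ (n + 1) = 1)
        (U : Bond d (towerP L m (n + 1)) → 𝔸ˣ) (_hU : ∀ b, U b ∈ U1 𝔸)
        (_hRS : ∀ (b : Bond d (towerP L m (n + 1))) (v u : W), ⟪adTransportW φ U b v, u⟫_ℂ = ⟪v, adTransportW φ (fun b => (U b)⁻¹) b u⟫_ℂ)
        (hU1 : ∀ (j : ℕ) (x : B7Prop1Explicit.Site d) (κ : Fin d), perCfg (towerP L m (j + 1)) (B9Eq315QTower.UlevOf L m (n + 1) U j) x κ ∈ U1 𝔸)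
        (hreg : ∀ (j : ℕ) (y : TSite d (towerP L m j)) (κ : Fin d) (r : Fin d → Fin L),
          ‖((Wcx L (perCfg (towerP L m (j + 1)) (B9Eq315QTower.UlevOf L m (n + 1) U j)) (cornerSite L y) κ (boxVec L r) : 𝔸ˣ) : 𝔸) - 1‖ ≤ α j)
        (hpos : ∀ x : BondL2K ℂ d (towerP L m (n + 1)) c₀ W, x ≠ 0 → 0 < RCLike.re ⟪x, laplaceAk L m n φ η U hL α hα1 hU1 hreg τ (c₀ := c₀) (c₁ := c₁) a x⟫_ℂ)
        (hQs : Function.Surjective (QkW L m n φ U hL α hα1 hU1 hreg (c₀ := c₀) (c₁ := c₁)))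
        (_hcoer : ∀ f : BondL2K ℂ d (towerP L m (n + 1)) c₀ W, γ * ‖f‖ ^ 2 ≤ RCLike.re ⟪f, laplaceAk L m n φ η U hL α hα1 hU1 hreg τ (c₀ := c₀) (c₁ := c₁) a f⟫_ℂ)
        (_hX1 : ∀ g : BondL2K ℂ d m c₁ W, μ₁ * ‖g‖ ^ 2 ≤ RCLike.re ⟪g, (QkW L m n φ U hL α hα1 hU1 hreg (c₀ := c₀) (c₁ := c₁)) (G1k L m n φ η U hL α hα1 hU1 hreg τ (c₀ := c₀) (c₁ := c₁) hpos (LinearMap.adjoint (QkW L m n φ U hL α hα1 hU1 hreg (c₀ := c₀) (c₁ := c₁)) g))⟫_ℂ)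
        (_hKre : ∀ f : BondL2K ℂ d (towerP L m (n + 1)) c₀ W, -(pK * ‖f‖ ^ 2) ≤ RCLike.re ⟪f, curvOp φ τ η U f⟫_ℂ)
        (_hQ : ∀ f, ‖(QkW L m n φ U hL α hα1 hU1 hreg (c₀ := c₀) (c₁ := c₁)) f‖ ≤ CQ * ‖f‖) (CP : ℝ) (_hCP : 0 ≤ CP) (_hCP2 : CP ^ 2 ≤ CQ / Real.sqrt κ₁)
        (_hQK : ∀ r : ℝ, 0 ≤ r → r ≤ r₀ → ∀ (χ : TSite d (towerP L m (n + 1)) → ℝ) (χ' : TSite d m → ℝ),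
          (∀ b : Bond d (towerP L m (n + 1)), |χ (bpos b) - χ (btgt b)| ≤ ℓ * η) →
          (∀ (y : TSite d m) (x : TSite d (towerP L m (n + 1))),
            siteCast (towerP_eq_fineP_pow L m (n + 1)) x ∈ B9Eq319QprimeTorus.blockOf (L ^ (n + 1)) m y → |χ' y - χ x| ≤ ℓ') →
          ∀ (MB : BondL2K ℂ d (towerP L m (n + 1)) c₀ W →L[ℂ] BondL2K ℂ d (towerP L m (n + 1)) c₀ W),
          (∀ (g : BondL2K ℂ d (towerP L m (n + 1)) c₀ W) (b : Bond d (towerP L m (n + 1))),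
            WL2.equiv ℂ (fun _ : Bond d (towerP L m (n + 1)) => c₀) W (MB g) b = (χ (bpos b) : ℂ) • WL2.equiv ℂ (fun _ : Bond d (towerP L m (n + 1)) => c₀) W g b) →
          ∀ (MS : SiteL2K ℂ d (towerP L m (n + 1)) c₀ W →L[ℂ] SiteL2K ℂ d (towerP L m (n + 1)) c₀ W),
          (∀ (g : SiteL2K ℂ d (towerP L m (n + 1)) c₀ W) (x : TSite d (towerP L m (n + 1))),
            WL2.equiv ℂ (fun _ : TSite d (towerP L m (n + 1)) => c₀) W (MS g) x = (χ x : ℂ) • WL2.equiv ℂ (fun _ : TSite d (towerP L m (n + 1)) => c₀) W g x) →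
          ∀ (MF : BondL2K ℂ d m c₁ W →L[ℂ] BondL2K ℂ d m c₁ W),
          (∀ (g : BondL2K ℂ d m c₁ W) (b' : Bond d m),
            WL2.equiv ℂ (fun _ : Bond d m => c₁) W (MF g) b' = (χ' (bpos b') : ℂ) • WL2.equiv ℂ (fun _ : Bond d m => c₁) W g b') →
          ∀ κ : ℂ, ‖κ‖ = r →
          (∀ f, ‖exp (κ • MF) ((QkW L m n φ U hL α hα1 hU1 hreg (c₀ := c₀) (c₁ := c₁)) (exp (κ • (-MB)) f)) - (QkW L m n φ U hL α hα1 hU1 hreg (c₀ := c₀) (c₁ := c₁)) f‖ ≤ (Nβ * r) * ‖f‖) ∧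
          (∀ g, ‖exp (κ • MB) (LinearMap.adjoint (QkW L m n φ U hL α hα1 hU1 hreg (c₀ := c₀) (c₁ := c₁)) (exp (κ • (-MF)) g)) - LinearMap.adjoint (QkW L m n φ U hL α hα1 hU1 hreg (c₀ := c₀) (c₁ := c₁)) g‖ ≤ (Nβ * r) * ‖g‖) ∧
          (∀ f, ‖exp (κ • MB) (curvOp φ τ η U (exp (κ • (-MB)) f)) - curvOp φ τ η U f‖ ≤ (NK * r) * ‖f‖) ∧
          (∀ s, ‖exp (κ • MS) (RofUk L m n φ η U (c₀ := c₀) (exp (κ • (-MS)) s)) - RofUk L m n φ η U (c₀ := c₀) s‖ ≤ (15 * ((Nβ * r) * sA) / Real.sqrt κ₁) * ‖s‖))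
        (_hP : ∀ f, ‖covDivL2K ℂ c₀ ((η : ℂ))⁻¹ (adTransportW φ fun b => (U b)⁻¹) f -
          RofUk L m n φ η U (c₀ := c₀) (covDivL2K ℂ c₀ ((η : ℂ))⁻¹ (adTransportW φ fun b => (U b)⁻¹) f)‖ ≤ CP * ‖f‖)
        (PB : TSite d m → BondL2K ℂ d (towerP L m (n + 1)) c₀ W →L[ℂ] BondL2K ℂ d (towerP L m (n + 1)) c₀ W)
        (_hPB : ∀ (y : TSite d m) (f : BondL2K ℂ d (towerP L m (n + 1)) c₀ W) (b : Bond d (towerP L m (n + 1))),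
          WL2.equiv ℂ (fun _ : Bond d (towerP L m (n + 1)) => c₀) W (PB y f) b =
            if blockCoord (L ^ (n + 1)) m (siteCast (towerP_eq_fineP_pow L m (n + 1)) (bpos b)) = y then
              WL2.equiv ℂ (fun _ : Bond d (towerP L m (n + 1)) => c₀) W f b else 0)
        (rF : TSite d m → BondL2K ℂ d m c₁ W →L[ℂ] BondL2K ℂ d m c₁ W)
        (_hrF : ∀ (y : TSite d m) (g : BondL2K ℂ d m c₁ W) (b' : Bond d m),
          WL2.equiv ℂ (fun _ : Bond d m => c₁) W (rF y g) b' = if bpos b' = y then WL2.equiv ℂ (fun _ : Bond d m => c₁) W g b' else 0)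
        (_hQa : ∀ z z', ‖PB z' ∘L LinearMap.toContinuousLinearMap (LinearMap.adjoint (QkW L m n φ U hL α hα1 hU1 hreg (c₀ := c₀) (c₁ := c₁))) ∘L rF z‖ ≤ CQa * Real.exp (-(r₀ * tdist m z z')))
        (y₀ y₁ : TSite d m),
        ‖PB y₁ ∘L LinearMap.toContinuousLinearMap (H1k L m n φ η U hL α hα1 hU1 hreg τ hαL hpos) ∘L rF y₀‖ ≤
          (4 / γ * Real.exp r₀) * CQa * (2 / μ₁ * Real.exp r₀) * latticeConst d (r₀ / 2) ^ 2 * Real.exp (-(r₀ / 2 * tdist m y₀ y₁)) := by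
  have hrc := radius0_pos (a := a) (pK := pK) (CQ := CQ) hγ ha hCQ hκ₁ hsA hμ₁ hNβ hNK hgap
  have hclose := fun (r CP : ℝ) (hr : 0 ≤ r) (hr0 : r ≤ min (1 / Nβ) (min (Real.sqrt κ₁ / (120 * sA * Nβ))
          (min ((γ / 4 - pK / 2) / (Nβ * (4 * Real.sqrt (CQ / Real.sqrt κ₁) + 30 * sA * CQ / κ₁ + (21 + 3 * a)) + NK))
            ((μ₁ / 2) / (Nβ * (4 / γ * (2 * CQ + 1) + CQ * (CQ + 1) *
              (4 / γ * (2 * (8 / γ) + (8 / γ + 4 / γ) + 2 * ((8 / γ + 4 / γ * Real.sqrt (CQ / Real.sqrt κ₁)) + 4 / γ) + a * CQ * (4 / γ) + a * (CQ + 1) * (4 / γ)) +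
                15 * sA * ((8 / γ + 4 / γ * Real.sqrt (CQ / Real.sqrt κ₁)) * ((8 / γ + 4 / γ * Real.sqrt (CQ / Real.sqrt κ₁)) + 4 / γ)) / Real.sqrt κ₁)) +
              NK * (CQ * (CQ + 1) * (4 / γ) ^ 2)))))) (hCP : 0 ≤ CP) (hCP2 : CP ^ 2 ≤ CQ / Real.sqrt κ₁) =>
    closing_of_r_le_radius0 (pK := pK) (μ₁ := μ₁) hγ ha hCQ hκ₁ hsA hNβ hNK hr hCP hCP2 hr0
  set rc : ℝ := min (1 / Nβ) (min (Real.sqrt κ₁ / (120 * sA * Nβ))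
          (min ((γ / 4 - pK / 2) / (Nβ * (4 * Real.sqrt (CQ / Real.sqrt κ₁) + 30 * sA * CQ / κ₁ + (21 + 3 * a)) + NK))
            ((μ₁ / 2) / (Nβ * (4 / γ * (2 * CQ + 1) + CQ * (CQ + 1) *
              (4 / γ * (2 * (8 / γ) + (8 / γ + 4 / γ) + 2 * ((8 / γ + 4 / γ * Real.sqrt (CQ / Real.sqrt κ₁)) + 4 / γ) + a * CQ * (4 / γ) + a * (CQ + 1) * (4 / γ)) +
                15 * sA * ((8 / γ + 4 / γ * Real.sqrt (CQ / Real.sqrt κ₁)) * ((8 / γ + 4 / γ * Real.sqrt (CQ / Real.sqrt κ₁)) + 4 / γ)) / Real.sqrt κ₁)) +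
              NK * (CQ * (CQ + 1) * (4 / γ) ^ 2))))) with hrc_def
  have hr₀pos : 0 < min rc R := lt_min hrc hR
  have hr₀0 : 0 ≤ min rc R := hr₀pos.le
  have hr₀c : min rc R ≤ rc := min_le_left _ _
  have hr₀R : min rc R ≤ R := min_le_right _ _
  have hβ1' : Nβ * min rc R ≤ 1 :=
    (hclose _ 0 hr₀0 hr₀c le_rfl (by rw [zero_pow two_ne_zero]; positivity)).1
  refine ⟨min rc R, by rw [hrc_def], hr₀pos, hr₀R, hβ1', ?_⟩
  intro n η hη hηL U hU hRS hU1 hreg hpos hQs hcoer hX1 hKre hQ CP hCP hCP2 hQK hP PB hPB rF hrF hQa y₀ y₁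
  obtain ⟨hβ1, hsmall, hρ8, -, hsmall2⟩ := hclose (min rc R) CP hr₀0 hr₀c hCP hCP2
  -- the radius window at this height: `r₀ℓη ≤ Rℓη ≤ L·η = L^{−n} ≤ 1`
  have hL1 : (1 : ℝ) ≤ L := by exact_mod_cast hL
  have hLpos : (0 : ℝ) < L := by linarith
  have hηLn : η * (L : ℝ) ^ n * L = 1 := by rw [mul_assoc, ← pow_succ]; exact hηL
  have hLn1 : (1 : ℝ) ≤ (L : ℝ) ^ n := one_le_pow₀ hL1
  have hηLle : η * (L : ℝ) ≤ 1 := by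
    have h1 : η * (L : ℝ) * 1 ≤ η * (L : ℝ) * (L : ℝ) ^ n := mul_le_mul_of_nonneg_left hLn1 (by positivity)
    calc η * (L : ℝ) = η * (L : ℝ) * 1 := by ring
      _ ≤ η * (L : ℝ) * (L : ℝ) ^ n := h1
      _ = η * (L : ℝ) ^ n * L := by ring
      _ = 1 := hηLn
  have hwin : min rc R * ℓ * η ≤ 1 :=
    calc min rc R * ℓ * η ≤ R * ℓ * η := by
          have := mul_le_mul_of_nonneg_right (mul_le_mul_of_nonneg_right hr₀R (by linarith : (0:ℝ) ≤ ℓ)) hη.le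
          exact this
      _ ≤ (L : ℝ) * η := mul_le_mul_of_nonneg_right hRL hη.le
      _ = η * L := by ring
      _ ≤ 1 := hηLle
  have hβ : 0 ≤ Nβ * min rc R := mul_nonneg hNβ.le hr₀0
  have hβCC : 4 * min rc R * ℓ * (Mφ * Mφ') * (d * Real.sqrt d) ≤ Nβ * min rc R :=
    calc 4 * min rc R * ℓ * (Mφ * Mφ') * (d * Real.sqrt d) = min rc R * (4 * ℓ * (Mφ * Mφ') * (d * Real.sqrt d)) := by ring
      _ ≤ min rc R * Nβ := mul_le_mul_of_nonneg_left hNβCC hr₀0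
      _ = Nβ * min rc R := by ring
  have hβC : 4 * min rc R * ℓ * (Mφ * Mφ') * d ≤ Nβ * min rc R :=
    calc 4 * min rc R * ℓ * (Mφ * Mφ') * d = min rc R * (4 * ℓ * (Mφ * Mφ') * d) := by ring
      _ ≤ min rc R * Nβ := mul_le_mul_of_nonneg_left hNβC hr₀0
      _ = Nβ * min rc R := by ring
  have hβD : 2 * min rc R * ℓ * (Mφ * Mφ') * Real.sqrt d ≤ Nβ * min rc R :=
    calc 2 * min rc R * ℓ * (Mφ * Mφ') * Real.sqrt d = min rc R * (2 * ℓ * (Mφ * Mφ') * Real.sqrt d) := by ring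
      _ ≤ min rc R * Nβ := mul_le_mul_of_nonneg_left hNβD hr₀0
      _ = Nβ * min rc R := by ring
  have hβK : 0 ≤ NK * min rc R := mul_nonneg hNK hr₀0
  have hρ : 0 ≤ 15 * ((Nβ * min rc R) * sA) / Real.sqrt κ₁ := by positivity
  have hr' : (0 : ℝ) ≤ min rc R / 2 := by positivity
  have hr'r : min rc R / 2 < min rc R := by linarith only [hr₀pos]
  have h := norm_block_H1k_le φ hφ hφ' hMφ hMφ' hη hηL U hU hRS τ hL α hα1 hU1 hreg a hαL ha hm hpos hQs hγ hγ1 hβ hβ1 hβK hℓ hℓ' hr₀0 hρ hρ8 hCP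
    hCQ hμ₁ hcoer hX1 hKre hQ hwin hβCC hβC hβD (hQK _ hr₀0 le_rfl) hP hsmall hsmall2 PB hPB hrF hCQa hr' hr'r hQa y₀ y₁
  have e : min rc R - min rc R / 2 = min rc R / 2 := by ring
  rw [e] at h
  exact h

end Literature.MathematicalPhysics.QuantumFieldTheory.Balaban1983to89.B9Eq3126H1BlockDecayUniformRadiusTower

end
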